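import Literature.MathematicalPhysics.QuantumFieldTheory.Balaban1983to89.B1Eq324BenfattoKernelSect5PerBoxAppD
import Literature.MathematicalPhysics.QuantumFieldTheory.Balaban1983to89.B1Eq324BenfattoKernelSect5PavementStep
import HarnessLib

/-!
# `Balaban1983to89.B1Eq324BenfattoKernelSect5PerBoxAtPavement` — [BenfattoEtAl1978] §5 pp. 157–159, THE PER-BOX RELATION AT THE CLASS ROAD'S
# PART FIELDS: the `hbox` hypothesis of the class pavement step (`…KernelSect5PavementStep.pavementStep_of_setIntegral`, seat n08-d) —
# `e^{ℓ_□}·∫_{χ^□_b} e^{Ψ′₁+Ψ₂} dN^K_{□,ξ} ≤ ∫_{χ^□_b} e^{Ψ_□} dN^K_{□,ξ}` for every tessera `□ ∈ B` and every corridor datum `ξ` — SUPPLIED from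
# the cluster-side rows (a)–(f) on the part kernels `K_□` and the centre `u_{Γ₁}(ξ)`, with `ℓ_□ := E_□ − Err_□` EXPLICIT; and the class
# pavement step with this hypothesis DISCHARGED — THE TWO HALVES OF THE §5 PORT JOINED

statement-level skeleton of published theorems with citation tags; proofs where landed; nothing here is a claim about the
Yang–Mills mass gap

WHY THIS MODULE (cell `pub-ymgap`, seat `dag-n08-c` gen 31; node N08 [Balaban1985UV3]; the [BenfattoEtAl1978] source chain behind the
(α)-row `h324`; ROW 10 = THE INSTANTIATION POINT of the seat's cluster-side port map `N08-PORT-MAP-CLUSTER-SIDE.md` §1).  The class road re-reads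
§5 of [BenfattoEtAl1978] for the Gaussian field of a coercive finite-range-dominated precision `A` on `Λ` (seat n08-d's structural side,
`N08-PORT-MAP-STRUCTURAL-SIDE.md`): its pavement step `…KernelSect5PavementStep.pavementStep_of_setIntegral` takes, for every tessera `□ = □_m`
(`m ∈ B`) and every datum `ξ` in the corridor event `χ^{Γ₁}_{γb}`, a per-box lower bound under the PART FIELD
`N^K_{□,ξ} = (gaussianFieldOfKernel (Kb m)).map (fun ζ x => condMean K (corridors L w B) ξ x + ζ x)` as the hypothesis `hbox`.  That part field IS
the shifted kernel field `μ_{Kb m, u_{Γ₁}(ξ)}` of the cluster-side rows 1–9 (`…KernelSect5SlotMoments` … `…KernelSect5PerBoxAppD`, this seat), so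
row 9's `perBox_shift_appD` delivers `hbox` with `ℓ_□ := E_□ − Err_□` once its rows are read at `(K, u) := (Kb m, condMean K Γ₁ ξ)`,
`K_r := K` (the class kernel itself = K_REF OF RECORD `K_Λ`, n08-b `N08-CLASS-TOOLKIT.md` §6).  Of those rows this file DISCHARGES: R0 (the part
kernel is positive semidefinite: `…KernelOfPrecision.isPosSemidefKernel_kernel` at the sub-precision, as n08-d does), R1 (`Kb m y y ≤ K₀` from the
a-priori row (a)), and the conditioning row (h) «`z = ξ` on `Γ₁`, `N^K_{□,ξ}`-a.s.» (n08-d `…KernelSect5Eq513.partField_ae_eqOn` with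
`…KernelSect5Eq515.shrink_subset_sdiff_corridors`); it DISPLAYS, uniformly in `m ∈ B` and `ξ ∈ χ^{Γ₁}_{γb}`, the rows (a) `|Kb m|, |K| ≤ K₀`, (b)
`|Kb m(x,y)| ≤ K₀e^{−δ₀ℓ¹(x,y)}`, (c) `|u_{Γ₁}(ξ)| ≤ Kᵤ` on `I`, (d)/(e) `|u_{Γ₁}(ξ)(x)|, |Kb m(x,y) − K(x,y)| ≤ ε₃₁` for `x ∈ □′∪Γ₃(□)`, (f)
`Kb m(x,x) ≤ ½`, `|u_{Γ₁}(ξ)(x)| ≤ ½b(1+d(Δ_x,I))` on `□′∪Γ₂(□)` — the class's depth rows (suppliers: `…KernelOfPrecision` F4/F5/F7 at the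
sub-precision + `…Sect5LegGeometry` §1; the optional «depth rows» module of the port map) — and the coefficient masses `M`, `M̃`.

WHAT IS PROVED (theorems only; no definition, no named fact, no `sorry`; axioms standard).
* ★★ `hbox_of_clusterRows` — the hypothesis `hbox` of `pavementStep_of_setIntegral` VERBATIM, with
  `ℓ m := E m − Err m`, `E m = Σ_{k<t}(Σ_{f uses Ψ″₁, avoids Ψ₂} 𝓔^T_{𝒩(0,K)}(f))/(k+1)!` (the reference cumulants of box `m`'s classes under the
  class field itself) and `Err m` row 9's error at box `m`.
* ★★★ `pavementStep_of_clusterRows` — `pavementStep_of_setIntegral` with `hbox` DISCHARGED by the above: ONE FULL PAVEMENT STEP FOR THE CLASS from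
  the structural data (n08-d's binders verbatim), print's coefficient data, and the displayed cluster rows (a)–(f) + masses — nothing else.

HONEST SCOPE / NOT HERE.  The depth rows (a)–(f) and the masses stay DISPLAYED (class suppliers named above; the port map's optional module); the
chain / ledger / knit over this step (structural S8) is n08-d's∕the assembler's; no generalised Basic Lemma is stated; one self-located row of an
UNCOMMISSIONED port (plan g81 (II), START-LIST v11 §n08) — nothing chained; nothing of [Balaban1985UV3] is asserted; count-neutral for N08;
nothing about d = 4, the continuum, OS axioms, a mass gap or the Clay problem.
-/

noncomputable section

open MeasureTheory ProbabilityTheory Finset Matrix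
open scoped BigOperators Nat NNReal

namespace Literature.MathematicalPhysics.QuantumFieldTheory.Balaban1983to89.B1Eq324BenfattoKernelSect5PerBoxAtPavement

open _root_.MeasureTheory _root_.ProbabilityTheory
open Literature.Probability.LatticeModels (setPartitions ursellOf)
open Literature.MathematicalPhysics.QuantumFieldTheory
open Literature.MathematicalPhysics.QuantumFieldTheory.Balaban1983to89.B1Eq324BenfattoLemma
open Literature.MathematicalPhysics.QuantumFieldTheory.Balaban1983to89.B1Eq324BenfattoSect5Boxes
open Literature.MathematicalPhysics.QuantumFieldTheory.Balaban1983to89.B1Eq324BenfattoSect5Eq511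
open Literature.MathematicalPhysics.QuantumFieldTheory.Balaban1983to89.B1Eq324BenfattoSect5Eq524
open Literature.MathematicalPhysics.QuantumFieldTheory.Balaban1983to89.B1Eq324BenfattoSect5Eq534
open Literature.MathematicalPhysics.QuantumFieldTheory.Balaban1983to89.B1Eq324BenfattoSect5Eq515
open Literature.MathematicalPhysics.QuantumFieldTheory.Balaban1983to89.B1Eq324BenfattoSect5Iteration (restrictCoef)
open Literature.MathematicalPhysics.QuantumFieldTheory.Balaban1983to89.B1Eq324BenfattoKernelOfPrecision (isPosSemidefKernel_kernel)
open Literature.MathematicalPhysics.QuantumFieldTheory.Balaban1983to89.B1Eq324BenfattoClassAppendixC (posDef_of_coercive)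
open Literature.MathematicalPhysics.QuantumFieldTheory.Balaban1983to89.B1Eq324BenfattoKernelSect5Eq513 (partField_ae_eqOn)
open Literature.MathematicalPhysics.QuantumFieldTheory.Balaban1983to89.B1Eq324BenfattoKernelSect5Eq515 (shrink_subset_sdiff_corridors)
open Literature.MathematicalPhysics.QuantumFieldTheory.Balaban1983to89.B1Eq324BenfattoKernelSect5PavementStep (pavementStep_of_setIntegral)
open Literature.MathematicalPhysics.QuantumFieldTheory.Balaban1983to89.B1Eq324BenfattoKernelSect5PerBoxAppD (perBox_shift_appD)
open Literature.MathematicalPhysics.QuantumFieldTheory.Balaban1983to89.B1Eq324GaussianMomentLeaf (momentConst)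

variable {d : ℕ}

/-! ## §1  `hbox` from the cluster rows -/

section HBox

variable {Λ : Finset (B1Eq324BenfattoLemma.Site d)} {A : Matrix Λ Λ ℝ}
  {K : B1Eq324BenfattoLemma.Site d → B1Eq324BenfattoLemma.Site d → ℝ}
  (hK : ∀ x y, K x y = if h : x ∈ Λ ∧ y ∈ Λ then (A⁻¹ : Matrix Λ Λ ℝ) ⟨x, h.1⟩ ⟨y, h.2⟩ else 0)
  {s D : ℕ} {κ : ℝ} {a : Coef d} {J I : Finset (B1Eq324BenfattoLemma.Site d)} {L w v : ℕ} {B : Finset (B1Eq324BenfattoLemma.Site d)}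
  {γ b Ac : ℝ}
  (hAs : ∀ e e', A e e' = A e' e) {γA : ℝ} (hγA0 : 0 < γA)
  (hγA : ∀ x : Λ → ℝ, γA * ∑ e, x e ^ 2 ≤ ∑ e, ∑ e', A e e' * x e * x e')
  (hL : 0 < L)
  (hΓΛ : corridors L w B ⊆ Λ) (hBΛ : ∀ m ∈ B, box L m ⊆ Λ)
  {Kb : B1Eq324BenfattoLemma.Site d → B1Eq324BenfattoLemma.Site d → B1Eq324BenfattoLemma.Site d → ℝ}
  (hKb : ∀ m (hm : m ∈ B) x y, Kb m x y = if h : x ∈ shrink L m w ∧ y ∈ shrink L m w then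
    ((A.submatrix (fun j : ↥(shrink L m w) => (⟨j, hBΛ m hm (shrink_subset_box L m w j.2)⟩ : Λ))
      (fun j : ↥(shrink L m w) => (⟨j, hBΛ m hm (shrink_subset_box L m w j.2)⟩ : Λ)))⁻¹ :
        Matrix ↥(shrink L m w) ↥(shrink L m w) ℝ) ⟨x, h.1⟩ ⟨y, h.2⟩ else 0)

include hK hAs hγA0 hγA hL hΓΛ hKb

/-- **`hbox` FROM THE CLUSTER ROWS**: for every tessera `□ = □_m`, `m ∈ B`, and every datum `ξ` with `χ^{Γ₁}_{γb}(ξ) = 1` (`Γ₁ = corridors L w B`),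
`e^{E_□ − Err_□} · ∫_{χ^□_b} e^{Ψ′₁+Ψ₂} dN^K_{□,ξ} ≤ ∫_{χ^□_b} e^{Ψ_□} dN^K_{□,ξ}` — row 9's `perBox_shift_appD` (fourth conjunct) read at the part field
`N^K_{□,ξ} = (gaussianFieldOfKernel (Kb m)).map (u_{Γ₁}(ξ) + ·)`, reference field the class field `𝒩(0,K)`; R0 from `isPosSemidefKernel_kernel` at the
sub-precision, R1 from row (a), the conditioning row from `partField_ae_eqOn`; rows (a)–(f) and the masses DISPLAYED uniformly in `m ∈ B` and in the
datum.  `E_□`, `Err_□` as in rows 8/9 (`…KernelSect5PerBoxOnData.perBox_shift`). [cite: BenfattoEtAl1978, (5.30)–(5.33) pp.158–159, (5.36) p.159] -/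
theorem hbox_of_clusterRows (hκ : 0 < κ) (hJ : CoefSupportedIn a J) (hJI : J ⊆ I) (hAc0 : 0 ≤ Ac)
    (hA : ∀ (p : ℕ) (Δ : Fin p → B1Eq324BenfattoLemma.Site d) (n : Fin p → ℕ), |a p Δ n| ≤ Ac)
    (hv : v ≤ w) (hb : 1 ≤ b) (hγ1 : γ ≤ 1)
    {Ku K₀ δ₀ ε₃₁ : ℝ} (hKu : 0 ≤ Ku) (hKuK : Ku ≤ K₀) (hK₀1 : 1 ≤ K₀) (hε₃₁ : 0 ≤ ε₃₁)
    (hu : ∀ ξ ∈ smallFieldOn (corridors L w B : Set (B1Eq324BenfattoLemma.Site d)) I (γ * b),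
      ∀ y ∈ I, |condMean K (corridors L w B) ξ y| ≤ Ku)
    (hKR : ∀ m ∈ B, ∀ x y, |Kb m x y| ≤ K₀) (hKrR : ∀ x y, |K x y| ≤ K₀)
    (hdec : ∀ m ∈ B, ∀ x y : B1Eq324BenfattoLemma.Site d,
      |Kb m x y| ≤ K₀ * Real.exp (-(δ₀ * ∑ jj, |((x jj : ℝ) - (y jj : ℝ))|)))
    (huε : ∀ m ∈ B, ∀ ξ ∈ smallFieldOn (corridors L w B : Set (B1Eq324BenfattoLemma.Site d)) I (γ * b),
      ∀ x ∈ shrink L m (w + (w - v)), |condMean K (corridors L w B) ξ x| ≤ ε₃₁)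
    (hKε : ∀ m ∈ B, ∀ x ∈ shrink L m (w + (w - v)), ∀ y, |Kb m x y - K x y| ≤ ε₃₁)
    (hvar : ∀ m ∈ B, ∀ x ∈ shrink L m w, Kb m x x ≤ 1 / 2)
    (hm : ∀ m ∈ B, ∀ ξ ∈ smallFieldOn (corridors L w B : Set (B1Eq324BenfattoLemma.Site d)) I (γ * b),
      ∀ x ∈ shrink L m w, |condMean K (corridors L w B) ξ x| ≤ 1 / 2 * b * (1 + distToRegion I x))
    (hsmall : ∀ m ∈ B, ((shrink L m w).card : ℝ) * Real.exp (-(b ^ 2 / 4)) ≤ 1 / 6)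
    (T : B1Eq324BenfattoLemma.Site d → Fin 3 → (p : ℕ) → Finset (Fin p → J))
    (hT0 : ∀ m p, T m 0 p = tuplesIn J p (frame4 L w v m) ∪ crossT J p (frame4 L w v m) (frame3 L w v m))
    (hT1 : ∀ m p, T m 1 p = (tuplesIn J p (core L w m) \ tuplesIn J p (frame4 L w v m)) ∪
      (crossT J p (core L w m) (frame3 L w v m) \ crossT J p (frame4 L w v m) (frame3 L w v m)))
    (hT2 : ∀ m p, T m 2 p = crossT J p (frame1 L w m) (frame2 L w m) ∪ tuplesIn J p (frame2 L w m))
    {M : ℝ} (hM : ∀ m c, ∑ p ∈ Finset.Icc 1 s, ∑ Δ ∈ T m c p, ∑ n ∈ admissible p D,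
      |a p (fun i => (Δ i : B1Eq324BenfattoLemma.Site d)) n| *
        Real.exp (-(κ / 2) * connLength fun i => (Δ i : B1Eq324BenfattoLemma.Site d)) ≤ M)
    {δ : ℝ} (hδ0 : 0 ≤ δ) (hδle : δ ≤ δ₀) {Mt : ℝ}
    (hMt : ∀ m c, ∑ p ∈ Finset.Icc 1 s, ∑ Δ ∈ T m c p, ∑ n ∈ admissible p D,
      |a p (fun i => (Δ i : B1Eq324BenfattoLemma.Site d)) n| *
        Real.exp (-(κ / 2) * connLength fun i => (Δ i : B1Eq324BenfattoLemma.Site d)) *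
        Real.exp (δ / 2 * ((D : ℝ) ^ 2 * (Real.sqrt d * connLength (fun i => (Δ i : B1Eq324BenfattoLemma.Site d)) + d))) ≤ Mt)
    (t : ℕ) :
    ∀ m ∈ B, ∀ ξ : B1Eq324BenfattoLemma.Site d → ℝ, ξ ∈ smallFieldOn (corridors L w B : Set (B1Eq324BenfattoLemma.Site d)) I (γ * b) →
      Real.exp
          ((∑ k ∈ Finset.range t,
              (∑ f ∈ univ.filter (fun f : Fin (k + 1) → Fin 3 => (∃ j, f j = 1) ∧ ∀ j, f j ≠ 2),
                ursellOf (fun P : Finset (Fin (k + 1)) => ∫ z, ∏ j ∈ P,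
                  (∑ p ∈ Finset.Icc 1 s, ∑ Δ ∈ T m (f j) p, ∑ n ∈ admissible p D, term κ a z p Δ n)
                    ∂(gaussianFieldOfKernel K)) univ) / (k + 1)!) -
            (2 * (2 ^ ((t + 1).choose 2) * (4 * (s1Const s D d κ * Ac * b ^ D * (L : ℝ) ^ d)) ^ (t + 1) / (t + 1)!) +
              Real.exp (2 * (4 * (s1Const s D d κ * Ac * b ^ D * (L : ℝ) ^ d))) *
                (3 * (((shrink L m w).card : ℝ) * Real.exp (-(b ^ 2 / 4)))) +
              ∑ k ∈ Finset.range t,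
                (3 ^ (k + 1) * ((∑ π ∈ setPartitions (univ : Finset (Fin (k + 1))), ((π.card - 1)! : ℝ)) *
                    (s1Const s D d κ * Ac * b ^ D * Real.exp (-(κ / 4 * v)) * (L : ℝ) ^ d *
                      (4 * (s1Const s D d κ * Ac * b ^ D * (L : ℝ) ^ d)) ^ k)) +
                  3 ^ (k + 1) * (2 ^ (k + 1) * ((∑ π ∈ setPartitions (univ : Finset (Fin (k + 1))), ((π.card - 1)! : ℝ)) *
                      ((min 1 (2 * ((shrink L m w).card : ℝ) * Real.exp (-(b ^ 2 / 4)))) ^ ((2 * (k + 1) : ℕ) : ℝ)⁻¹ *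
                        ((1 + Ku) ^ D * M * momentConst D (2 * (k + 1)) K₀.toNNReal) ^ (k + 1))) +
                    2 ^ ((k + 1) * D) * 2 ^ 2 ^ ((k + 1) * D) * K₀ ^ ((k + 1) * D) * Real.exp (-(δ / 2 * ((v : ℝ) + 1))) *
                      Mt ^ (k + 1)) +
                  3 ^ (k + 1) * (2 ^ (k + 1) * ((∑ π ∈ setPartitions (univ : Finset (Fin (k + 1))), ((π.card - 1)! : ℝ)) *
                      ((min 1 (2 * ((shrink L m w).card : ℝ) * Real.exp (-(b ^ 2 / 4)))) ^ ((2 * (k + 1) : ℕ) : ℝ)⁻¹ *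
                        ((1 + Ku) ^ D * M * momentConst D (2 * (k + 1)) K₀.toNNReal) ^ (k + 1))) +
                    M ^ (k + 1) * (2 ^ ((k + 1) * D) * 2 ^ 2 ^ ((k + 1) * D) *
                      ((((k + 1) * D : ℕ) : ℝ) * K₀ ^ ((k + 1) * D) * ε₃₁)))) / (k + 1)!)) *
        ∫ z in smallFieldOn (shrink L m w : Set (B1Eq324BenfattoLemma.Site d)) I b,
          Real.exp (psi1p s D κ a L w v m z + psi2 s D κ a L w m z) ∂((gaussianFieldOfKernel (Kb m)).map
              fun (ζ : B1Eq324BenfattoLemma.Site d → ℝ) (x : B1Eq324BenfattoLemma.Site d) => condMean K (corridors L w B) ξ x + ζ x)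
        ≤ ∫ z in smallFieldOn (shrink L m w : Set (B1Eq324BenfattoLemma.Site d)) I b,
          Real.exp (psiBox s D κ a L w m z) ∂((gaussianFieldOfKernel (Kb m)).map
              fun (ζ : B1Eq324BenfattoLemma.Site d → ℝ) (x : B1Eq324BenfattoLemma.Site d) => condMean K (corridors L w B) ξ x + ζ x) := by
  intro m hmB ξ hξ
  have hA' : A.PosDef := posDef_of_coercive hAs hγA0 hγA
  -- R0 for the part kernel and for the class kernel
  have hKbpsd : IsPosSemidefKernel (Kb m) :=
    isPosSemidefKernel_kernel (hKb m hmB) (hA'.submatrix fun a b hab => Subtype.ext (by simpa using congrArg Subtype.val hab))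
  have hKpsd : IsPosSemidefKernel K := isPosSemidefKernel_kernel hK hA'
  -- R1 from row (a)
  have hdiag : ∀ y, Kb m y y ≤ (K₀.toNNReal : ℝ) := fun y =>
    ((le_abs_self _).trans (hKR m hmB y y)).trans (Real.le_coe_toNNReal K₀)
  have hdiagr : ∀ y, K y y ≤ (K₀.toNNReal : ℝ) := fun y =>
    ((le_abs_self _).trans (hKrR y y)).trans (Real.le_coe_toNNReal K₀)
  -- the datum on `Γ₁`
  have hξ' : ∀ c ∈ corridors L w B, |ξ c| ≤ γ * b * (1 + distToRegion I c) := fun c hc => by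
    have h := hξ
    simp only [smallFieldOn, Set.mem_setOf_eq] at h
    exact h c (Finset.mem_coe.2 hc)
  -- the conditioning row (h)
  have hae := partField_ae_eqOn hK hA' hΓΛ (shrink_subset_sdiff_corridors hL hBΛ hmB) (hKb m hmB) ξ
  exact (perBox_shift_appD hKbpsd (condMean K (corridors L w B) ξ) hdiag hKpsd hdiagr hκ hJ hJI hAc0 hA hv hb hγ1 hKu hKuK hK₀1
    hε₃₁ (hu ξ hξ) (hKR m hmB) hKrR (hdec m hmB) (huε m hmB ξ hξ) (hKε m hmB) (hvar m hmB) (hm m hmB ξ hξ)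
    (frame1_subset_corridors L w hmB) hξ' hae (hsmall m hmB) (T m) (hT0 m) (hT1 m) (hT2 m) (hM m) hδ0 hδle (hMt m) t).2.2.2.1

end HBox

/-! ## §2  The class pavement step with `hbox` discharged -/

section Step

variable {Λ : Finset (B1Eq324BenfattoLemma.Site d)} {A : Matrix Λ Λ ℝ}
  {K : B1Eq324BenfattoLemma.Site d → B1Eq324BenfattoLemma.Site d → ℝ}
  (hK : ∀ x y, K x y = if h : x ∈ Λ ∧ y ∈ Λ then (A⁻¹ : Matrix Λ Λ ℝ) ⟨x, h.1⟩ ⟨y, h.2⟩ else 0)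
  {s D : ℕ} {κ : ℝ} {a : Coef d} {J I : Finset (B1Eq324BenfattoLemma.Site d)} {L w v : ℕ} {B : Finset (B1Eq324BenfattoLemma.Site d)}
  {γ b Ac : ℝ}
  (hAs : ∀ e e', A e e' = A e' e) {γA rmax : ℝ} (hγA0 : 0 < γA)
  (hγA : ∀ x : Λ → ℝ, γA * ∑ e, x e ^ 2 ≤ ∑ e, ∑ e', A e e' * x e * x e')
  (hJI : J ⊆ I) (hL : 0 < L) (hγ1 : γ ≤ 1) (hb : 1 ≤ b)
  (hΓΛ : corridors L w B ⊆ Λ) (hBΛ : ∀ m ∈ B, box L m ⊆ Λ)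
  (π : ↥(Λ \ corridors L w B) → Option ↥B)
  (hπ : ∀ (y : ↥(Λ \ corridors L w B)) (m : ↥B), π y = some m ↔ (y : B1Eq324BenfattoLemma.Site d) ∈ shrink L (m : B1Eq324BenfattoLemma.Site d) w)
  (r : ↥(Λ \ corridors L w B) → ℝ)
  (hr : ∀ y : ↥(Λ \ corridors L w B), ∑ y' : ↥(Λ \ corridors L w B), (if π y = π y' then (0 : ℝ) else
    |A ⟨y, (Finset.mem_sdiff.mp y.2).1⟩ ⟨y', (Finset.mem_sdiff.mp y'.2).1⟩|) ≤ r y)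
  (hrmax : ∀ y, r y ≤ rmax) (hγr : rmax < γA)
  {Kb : B1Eq324BenfattoLemma.Site d → B1Eq324BenfattoLemma.Site d → B1Eq324BenfattoLemma.Site d → ℝ}
  (hKb : ∀ m (hm : m ∈ B) x y, Kb m x y = if h : x ∈ shrink L m w ∧ y ∈ shrink L m w then
    ((A.submatrix (fun j : ↥(shrink L m w) => (⟨j, hBΛ m hm (shrink_subset_box L m w j.2)⟩ : Λ))
      (fun j : ↥(shrink L m w) => (⟨j, hBΛ m hm (shrink_subset_box L m w j.2)⟩ : Λ)))⁻¹ :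
        Matrix ↥(shrink L m w) ↥(shrink L m w) ℝ) ⟨x, h.1⟩ ⟨y, h.2⟩ else 0)
  {Kout : B1Eq324BenfattoLemma.Site d → B1Eq324BenfattoLemma.Site d → ℝ}
  (hKout : ∀ x y, Kout x y =
    if h : x ∈ ((Λ \ corridors L w B).filter fun x => ∀ m ∈ B, x ∉ box L m) ∧
        y ∈ ((Λ \ corridors L w B).filter fun x => ∀ m ∈ B, x ∉ box L m) then
      ((A.submatrix
          (fun j : ↥((Λ \ corridors L w B).filter fun x => ∀ m ∈ B, x ∉ box L m) =>
            (⟨j, (Finset.mem_sdiff.mp (Finset.mem_filter.mp j.2).1).1⟩ : Λ))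
          (fun j : ↥((Λ \ corridors L w B).filter fun x => ∀ m ∈ B, x ∉ box L m) =>
            (⟨j, (Finset.mem_sdiff.mp (Finset.mem_filter.mp j.2).1).1⟩ : Λ)))⁻¹ :
        Matrix ↥((Λ \ corridors L w B).filter fun x => ∀ m ∈ B, x ∉ box L m)
          ↥((Λ \ corridors L w B).filter fun x => ∀ m ∈ B, x ∉ box L m) ℝ) ⟨x, h.1⟩ ⟨y, h.2⟩ else 0)
  {Cu : ℝ}
  (hu : ∀ ξ ∈ smallFieldOn (corridors L w B : Set (B1Eq324BenfattoLemma.Site d)) I (γ * b),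
    ∀ y ∈ Λ \ corridors L w B, |condMean K (corridors L w B) ξ y| ≤ Cu * b * (1 + distToRegion I y))
  {T : ℝ} (hT : (1 + Cu) ^ 2 * b ^ 2 * ∑ y : ↥(Λ \ corridors L w B), r y * (1 + distToRegion I y) ^ 2 ≤ T)

include hK hAs hγA0 hγA hJI hL hγ1 hb hΓΛ hBΛ hπ hr hrmax hγr hKb hKout hu hT

/-- **ONE FULL PAVEMENT STEP FOR THE CLASS, THE PER-BOX HYPOTHESIS DISCHARGED FROM THE CLUSTER ROWS** — n08-d's
`…KernelSect5PavementStep.pavementStep_of_setIntegral` (its binders VERBATIM: the class data `(Λ, A, γ_A)`, the pavement inside `Λ`, the cross-row budget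
`r ≤ rmax < γ_A`, the part kernels `Kb`, the far kernel `Kout`, the corridor centre row `hu`, the budget `T`) with `ℓ_□ := E_□ − Err_□` and `hbox` SUPPLIED by
`hbox_of_clusterRows`: `exp(−err₅₁₁ − err₅₃₄ − 2(ρ + T∕2) + Σ_{□∈B}(E_□ − Err_□))·∫ Πχ̂^{γb} e^{H^{A|Γ̄₁}_{J∩Γ̄₁}} dμ_K ≤ ∫ Πχ̂^b e^{H^A_J} dμ_K` — from the
structural data, print's coefficient data (`|A^n_Δ| ≤ Ac` globally, `J ⊆ I`, `v ≤ w`, `1 ≤ b`, `γ ≤ 1`) and the DISPLAYED cluster rows (a)–(f) + masses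
`M`, `M̃` of `hbox_of_clusterRows`, nothing else.  THE TWO HALVES OF THE §5 PORT JOINED AT ONE STEP.
[cite: BenfattoEtAl1978, §5 (5.9)–(5.15) p.155, (5.30)–(5.35) pp.158–159 (class substitute at temperature zero; ours)] -/
theorem pavementStep_of_clusterRows (hκ : 0 < κ) (hJ : CoefSupportedIn a J) (hAc0 : 0 ≤ Ac)
    (hA : ∀ (p : ℕ) (Δ : Fin p → B1Eq324BenfattoLemma.Site d) (n : Fin p → ℕ), |a p Δ n| ≤ Ac)
    (hv : v ≤ w) (hB : J.image (boxIndex L) ⊆ B)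
    {Ku K₀ δ₀ ε₃₁ : ℝ} (hKu : 0 ≤ Ku) (hKuK : Ku ≤ K₀) (hK₀1 : 1 ≤ K₀) (hε₃₁ : 0 ≤ ε₃₁)
    (huI : ∀ ξ ∈ smallFieldOn (corridors L w B : Set (B1Eq324BenfattoLemma.Site d)) I (γ * b),
      ∀ y ∈ I, |condMean K (corridors L w B) ξ y| ≤ Ku)
    (hKR : ∀ m ∈ B, ∀ x y, |Kb m x y| ≤ K₀) (hKrR : ∀ x y, |K x y| ≤ K₀)
    (hdec : ∀ m ∈ B, ∀ x y : B1Eq324BenfattoLemma.Site d,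
      |Kb m x y| ≤ K₀ * Real.exp (-(δ₀ * ∑ jj, |((x jj : ℝ) - (y jj : ℝ))|)))
    (huε : ∀ m ∈ B, ∀ ξ ∈ smallFieldOn (corridors L w B : Set (B1Eq324BenfattoLemma.Site d)) I (γ * b),
      ∀ x ∈ shrink L m (w + (w - v)), |condMean K (corridors L w B) ξ x| ≤ ε₃₁)
    (hKε : ∀ m ∈ B, ∀ x ∈ shrink L m (w + (w - v)), ∀ y, |Kb m x y - K x y| ≤ ε₃₁)
    (hvar : ∀ m ∈ B, ∀ x ∈ shrink L m w, Kb m x x ≤ 1 / 2)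
    (hm : ∀ m ∈ B, ∀ ξ ∈ smallFieldOn (corridors L w B : Set (B1Eq324BenfattoLemma.Site d)) I (γ * b),
      ∀ x ∈ shrink L m w, |condMean K (corridors L w B) ξ x| ≤ 1 / 2 * b * (1 + distToRegion I x))
    (hsmall : ∀ m ∈ B, ((shrink L m w).card : ℝ) * Real.exp (-(b ^ 2 / 4)) ≤ 1 / 6)
    (Tc : B1Eq324BenfattoLemma.Site d → Fin 3 → (p : ℕ) → Finset (Fin p → J))
    (hT0 : ∀ m p, Tc m 0 p = tuplesIn J p (frame4 L w v m) ∪ crossT J p (frame4 L w v m) (frame3 L w v m))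
    (hT1 : ∀ m p, Tc m 1 p = (tuplesIn J p (core L w m) \ tuplesIn J p (frame4 L w v m)) ∪
      (crossT J p (core L w m) (frame3 L w v m) \ crossT J p (frame4 L w v m) (frame3 L w v m)))
    (hT2 : ∀ m p, Tc m 2 p = crossT J p (frame1 L w m) (frame2 L w m) ∪ tuplesIn J p (frame2 L w m))
    {M : ℝ} (hM : ∀ m c, ∑ p ∈ Finset.Icc 1 s, ∑ Δ ∈ Tc m c p, ∑ n ∈ admissible p D,
      |a p (fun i => (Δ i : B1Eq324BenfattoLemma.Site d)) n| *
        Real.exp (-(κ / 2) * connLength fun i => (Δ i : B1Eq324BenfattoLemma.Site d)) ≤ M)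
    {δ : ℝ} (hδ0 : 0 ≤ δ) (hδle : δ ≤ δ₀) {Mt : ℝ}
    (hMt : ∀ m c, ∑ p ∈ Finset.Icc 1 s, ∑ Δ ∈ Tc m c p, ∑ n ∈ admissible p D,
      |a p (fun i => (Δ i : B1Eq324BenfattoLemma.Site d)) n| *
        Real.exp (-(κ / 2) * connLength fun i => (Δ i : B1Eq324BenfattoLemma.Site d)) *
        Real.exp (δ / 2 * ((D : ℝ) ^ 2 * (Real.sqrt d * connLength (fun i => (Δ i : B1Eq324BenfattoLemma.Site d)) + d))) ≤ Mt)
    (t : ℕ) :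
    Real.exp (-(s1Const s D d κ * Ac * b ^ D * Real.exp (-(κ / 4 * w)) * J.card)
        - s1Const s D d κ * Ac * b ^ D *
          (Real.exp (-(κ / 4 * w)) * (corridorsBar L w v B).card + Real.exp (-(κ / 4 * v)) * (B.card * (L : ℝ) ^ d))
        - 2 * ((∑ y, r y) / (γA - rmax) + T / 2) + ∑ m ∈ B,
          ((∑ k ∈ Finset.range t,
              (∑ f ∈ univ.filter (fun f : Fin (k + 1) → Fin 3 => (∃ j, f j = 1) ∧ ∀ j, f j ≠ 2),
                ursellOf (fun P : Finset (Fin (k + 1)) => ∫ z, ∏ j ∈ P,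
                  (∑ p ∈ Finset.Icc 1 s, ∑ Δ ∈ Tc m (f j) p, ∑ n ∈ admissible p D, term κ a z p Δ n)
                    ∂(gaussianFieldOfKernel K)) univ) / (k + 1)!) -
            (2 * (2 ^ ((t + 1).choose 2) * (4 * (s1Const s D d κ * Ac * b ^ D * (L : ℝ) ^ d)) ^ (t + 1) / (t + 1)!) +
              Real.exp (2 * (4 * (s1Const s D d κ * Ac * b ^ D * (L : ℝ) ^ d))) *
                (3 * (((shrink L m w).card : ℝ) * Real.exp (-(b ^ 2 / 4)))) +
              ∑ k ∈ Finset.range t,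
                (3 ^ (k + 1) * ((∑ π ∈ setPartitions (univ : Finset (Fin (k + 1))), ((π.card - 1)! : ℝ)) *
                    (s1Const s D d κ * Ac * b ^ D * Real.exp (-(κ / 4 * v)) * (L : ℝ) ^ d *
                      (4 * (s1Const s D d κ * Ac * b ^ D * (L : ℝ) ^ d)) ^ k)) +
                  3 ^ (k + 1) * (2 ^ (k + 1) * ((∑ π ∈ setPartitions (univ : Finset (Fin (k + 1))), ((π.card - 1)! : ℝ)) *
                      ((min 1 (2 * ((shrink L m w).card : ℝ) * Real.exp (-(b ^ 2 / 4)))) ^ ((2 * (k + 1) : ℕ) : ℝ)⁻¹ *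
                        ((1 + Ku) ^ D * M * momentConst D (2 * (k + 1)) K₀.toNNReal) ^ (k + 1))) +
                    2 ^ ((k + 1) * D) * 2 ^ 2 ^ ((k + 1) * D) * K₀ ^ ((k + 1) * D) * Real.exp (-(δ / 2 * ((v : ℝ) + 1))) *
                      Mt ^ (k + 1)) +
                  3 ^ (k + 1) * (2 ^ (k + 1) * ((∑ π ∈ setPartitions (univ : Finset (Fin (k + 1))), ((π.card - 1)! : ℝ)) *
                      ((min 1 (2 * ((shrink L m w).card : ℝ) * Real.exp (-(b ^ 2 / 4)))) ^ ((2 * (k + 1) : ℕ) : ℝ)⁻¹ *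
                        ((1 + Ku) ^ D * M * momentConst D (2 * (k + 1)) K₀.toNNReal) ^ (k + 1))) +
                    M ^ (k + 1) * (2 ^ ((k + 1) * D) * 2 ^ 2 ^ ((k + 1) * D) *
                      ((((k + 1) * D : ℕ) : ℝ) * K₀ ^ ((k + 1) * D) * ε₃₁)))) / (k + 1)!))) *
        ∫ z, cutoffBoltzmann (hamiltonian s D κ (restrictCoef a (corridorsBar L w v B)) (J ∩ corridorsBar L w v B)) I (γ * b) z ∂gaussianFieldOfKernel K
      ≤ ∫ z, cutoffBoltzmann (hamiltonian s D κ a J) I b z ∂gaussianFieldOfKernel K :=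
  pavementStep_of_setIntegral hK hAs hγA0 hγA hJI hL hγ1 hb hΓΛ hBΛ π hπ r hr hrmax hγr hKb hKout hu hT hκ hJ hAc0
    (fun p _ Δ _ n _ => hA p Δ n) hv hB _
    (hbox_of_clusterRows hK hAs hγA0 hγA hL hΓΛ hBΛ hKb hκ hJ hJI hAc0 hA hv hb hγ1 hKu hKuK hK₀1 hε₃₁ huI hKR hKrR hdec huε hKε hvar
      hm hsmall Tc hT0 hT1 hT2 hM hδ0 hδle hMt t)

end Step

end Literature.MathematicalPhysics.QuantumFieldTheory.Balaban1983to89.B1Eq324BenfattoKernelSect5PerBoxAtPavement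

end
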